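import Literature.AlgebraicGeometry.Resolution.Temkin2008LocalizationProofs
import Literature.AlgebraicGeometry.Resolution.ResolutionLocalization
import Literature.AlgebraicGeometry.Resolution.DerivativeIdealsSupport
import Literature.AlgebraicGeometry.Resolution.NormalCrossingsStrictification
import HarnessLib

/-!
# Crux `PatchingRelPerfect` (stmt-ResolutionOfSingularities-16161), line `closed-point-slice`:
# the roof engine, CLOSED STEP (sub-goal `stub_roofEngineClosedStep` of the stub `stub_roofEngine`)

Route `ResolutionOfSingularities/FrobeniusClosing`, crux #6 `PatchingRelPerfect`. The stub
`stub_roofEngine` of the line `closed-point-slice` (skeleton v2.1) runs Temkin's Noetherian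
induction (Temkin 2008, proof of Prop. 2.3.4; tree `temkin2008_prop234_of_comp`) on the closed bad
set `C` of an integral fourfold `M` over a perfect field `k`, feeding the step at NON-closed maximal
bad points with local desingularizations and the step at CLOSED bad points with the algebraized
atom under a REGULAR ROOF `q : M → N`. This file proves the CLOSED STEP
(`stub_roofEngineClosedStep`) and the facts about the local scheme `T = X' ×_N Spec 𝒪_{N,n}` it
consumes, all sorry-free:

* `fromSpecStalk_genericPoint` — `Spec 𝒪_{N,n} → N` hits the generic point with its generic
  point (`N` integral);
* `isBirational_pullback_snd_fromSpecStalk` — birationality of `X' → N` survives the base change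
  to `Spec 𝒪_{N,n}` (the good open pulls back to an open containing the generic point, its
  preimage contains the point over `(ξ', η_N)`, generic since `T → X'` is an embedding);
* `isIntegral_pullback_fromSpecStalk` — `T` is integral (irreducible as the source of a
  birational morphism to `Spec` of a domain; reduced since `T → X'` identifies local rings);
* `finite_residue_stalk_overHom` — the residue field of a CLOSED point of a scheme locally of
  finite type over `k` is finite over `k` (the prime is maximal on an affine chart, localization
  preserves the residue field, Zariski's lemma);
* `stub_roofEngineClosedStep` — the closed step itself (statement and proof in its docstring).

## Sources

* M. Temkin, *Desingularization of quasi-excellent schemes in characteristic zero*, Adv. Math.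
  219 (2008) 488–522 = arXiv:math/0703678: §2.1 (pro-open pro-subschemes, Lemma 2.1.1),
  Prop. 2.3.4 and its proof (p. 12, arXiv pagination). [Temkin2008]
* The Stacks Project, Tags 01J7 (`Spec 𝒪_{X,x} → X`), 01RN (birational), 02IZ
  (`dim 𝒪_{X,x}`), 00FZ (Zariski's lemma / Hilbert Nullstellensatz). [StacksProject]
* U. Görtz, T. Wedhorn, *Algebraic Geometry I* (2nd ed., 2020), Prop. 13.91 (blow-ups and flat
  base change), (13.19) (uniqueness of blow-ups). [GortzWedhorn2020]
-/

set_option linter.dupNamespace false -- single-problem summit: doubled namespace component is forced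

noncomputable section

open CategoryTheory CategoryTheory.Limits AlgebraicGeometry Literature.AlgebraicGeometry.Resolution
open TopologicalSpace IsLocalRing

namespace Summit.ResolutionOfSingularities.ResolutionOfSingularities.Theorems

universe u

/-! ## The local scheme `X' ×_N Spec 𝒪_{N,n}` over a point of an integral base -/

/-- `Spec 𝒪_{N,n} → N` sends the generic point to the generic point (`N` integral): its image is
the set of generizations of `n`, which contains `η_N`, and `η_N` has no proper generization.
[cite: StacksProject, Tag 01J7] -/
theorem fromSpecStalk_genericPoint {N : Scheme.{u}} [IsIntegral N] (n : N) :
    N.fromSpecStalk n (genericPoint (Spec (N.presheaf.stalk n))) = genericPoint N := by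
  haveI : IrreducibleSpace (Spec (N.presheaf.stalk n) : Scheme.{u}) :=
    inferInstanceAs (IrreducibleSpace (PrimeSpectrum (N.presheaf.stalk n)))
  obtain ⟨s₀, hs₀⟩ : genericPoint N ∈ Set.range (N.fromSpecStalk n) := by
    rw [Scheme.range_fromSpecStalk]
    exact genericPoint_specializes n
  have h : N.fromSpecStalk n (genericPoint (Spec (N.presheaf.stalk n))) ⤳ genericPoint N := by
    rw [← hs₀]
    exact (genericPoint_specializes s₀).map (N.fromSpecStalk n).continuous
  exact (h.antisymm (genericPoint_specializes _)).eq

/-- **Birationality survives the base change to a local scheme of the base.** If `h : X' → N`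
(`X'` irreducible, `N` integral) is an isomorphism over the dense open `U` with dense preimage,
then `X' ×_N Spec 𝒪_{N,n} → Spec 𝒪_{N,n}` is an isomorphism over the preimage of `U`, which
contains the generic point of `Spec 𝒪_{N,n}`, and its own preimage contains the point over
`(ξ', η)`, which is generic in the base change because the projection to `X'` is a topological
embedding. [cite: StacksProject, Tag 01RN] -/
theorem isBirational_pullback_snd_fromSpecStalk {X' N : Scheme.{u}} [IsIntegral N]
    [IrreducibleSpace X'] (h : X' ⟶ N) (hbir : IsBirational h) (n : N) :
    IsBirational (pullback.snd h (N.fromSpecStalk n)) := by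
  obtain ⟨U, hU, -, hiso⟩ := hbir
  haveI := hiso
  haveI : IrreducibleSpace (Spec (N.presheaf.stalk n) : Scheme.{u}) :=
    inferInstanceAs (IrreducibleSpace (PrimeSpectrum (N.presheaf.stalk n)))
  have hιη : N.fromSpecStalk n (genericPoint (Spec (N.presheaf.stalk n))) = genericPoint N :=
    fromSpecStalk_genericPoint n
  have hπξ : h (genericPoint X') = genericPoint N :=
    apply_genericPoint_eq_of_isIso_morphismRestrict h U hU
  have hηU : genericPoint N ∈ (U : Set N) := genericPoint_mem_of_isOpen U.2 hU.nonempty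
  obtain ⟨z, hz1, hz2⟩ := Scheme.Pullback.exists_preimage_pullback (f := h)
    (g := N.fromSpecStalk n) (genericPoint X') (genericPoint (Spec (N.presheaf.stalk n)))
    (hπξ.trans hιη.symm)
  refine ⟨N.fromSpecStalk n ⁻¹ᵁ U, ?_, ?_,
    Literature.AlgebraicGeometry.Morphisms.isIso_morphismRestrict_pullback_snd h _ U⟩
  · refine dense_of_genericPoint_mem_of_irreducibleSpace ?_
    change N.fromSpecStalk n (genericPoint (Spec (N.presheaf.stalk n))) ∈ (U : Set N)
    rw [hιη]
    exact hηU
  · have hz : z ∈ ((pullback.snd h (N.fromSpecStalk n) ⁻¹ᵁ (N.fromSpecStalk n ⁻¹ᵁ U) :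
        (pullback h (N.fromSpecStalk n)).Opens) : Set _) := by
      change N.fromSpecStalk n (pullback.snd h (N.fromSpecStalk n) z) ∈ (U : Set N)
      rw [hz2, hιη]
      exact hηU
    refine Dense.mono (Set.singleton_subset_iff.mpr hz) ?_
    rw [dense_iff_inter_open]
    intro W hW hWne
    obtain ⟨t, ht, htW⟩ :=
      (pullback.fst h (N.fromSpecStalk n)).isEmbedding.isInducing.isOpen_iff.mp hW
    obtain ⟨w, hw⟩ := hWne
    have hwt : pullback.fst h (N.fromSpecStalk n) w ∈ t := by
      rw [← htW] at hw
      exact hw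
    have hξt : genericPoint X' ∈ t := genericPoint_mem_of_isOpen ht ⟨_, hwt⟩
    refine ⟨z, ?_, rfl⟩
    rw [← htW]
    change pullback.fst h (N.fromSpecStalk n) z ∈ t
    rwa [hz1]

/-- **The local scheme `X' ×_N Spec 𝒪_{N,n}` of an integral `X'` birational over the integral
`N` is integral**: irreducible as the source of a birational morphism onto `Spec` of a domain,
reduced because the projection to `X'` identifies local rings. [cite: Temkin2008, §2.1 (p. 6)] -/
theorem isIntegral_pullback_fromSpecStalk {X' N : Scheme.{u}} [IsIntegral N] [IsIntegral X']
    (h : X' ⟶ N) (hbir : IsBirational h) (n : N) :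
    IsIntegral (pullback h (N.fromSpecStalk n)) := by
  haveI : IrreducibleSpace (Spec (N.presheaf.stalk n) : Scheme.{u}) :=
    inferInstanceAs (IrreducibleSpace (PrimeSpectrum (N.presheaf.stalk n)))
  haveI : IrreducibleSpace ↑(pullback h (N.fromSpecStalk n)) :=
    (isBirational_pullback_snd_fromSpecStalk h hbir n).irreducibleSpace
  haveI : ∀ t : ↑(pullback h (N.fromSpecStalk n)),
      _root_.IsReduced ((pullback h (N.fromSpecStalk n)).presheaf.stalk t) := fun t => by
    haveI := isIso_stalkMap_pullback_fst_fromSpecStalk h n t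
    exact isReduced_of_injective
      (asIso ((pullback.fst h (N.fromSpecStalk n)).stalkMap t)).commRingCatIsoToRingEquiv.symm
      (asIso ((pullback.fst h (N.fromSpecStalk n)).stalkMap t)).commRingCatIsoToRingEquiv.symm.injective
  haveI : IsReduced (pullback h (N.fromSpecStalk n)) := isReduced_of_isReduced_stalk _
  exact isIntegral_of_irreducibleSpace_of_isReduced _

/-! ## The local ring at a closed point of a scheme of finite type over a field -/

/-- **The residue field at a closed point of a scheme locally of finite type over a field `k`
is finite over `k`** (for the `k`-structure `stalkAlgebra (overHom k N) n` of `𝒪_{N,n}`): on an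
affine open `U ∋ n` the prime of `n` is maximal, `Γ(N, U) → 𝒪_{N,n}/𝔪` is surjective
(localization preserves the residue field at a maximal ideal), so `𝒪_{N,n}/𝔪` is a field of
finite type over `k`, hence finite (Zariski's lemma). [cite: StacksProject, Tag 00FZ] -/
theorem finite_residue_stalk_overHom (k : Type u) [Field k] (N : Scheme.{u})
    [N.Over (Spec (.of k))] [LocallyOfFiniteType (N ↘ Spec (.of k))] (n : N)
    (hn : IsClosed ({n} : Set N)) :
    letI := stalkAlgebra (overHom k N) n
    Module.Finite k (N.presheaf.stalk n ⧸ maximalIdeal (N.presheaf.stalk n)) := by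
  obtain ⟨U, hU, hnU, -⟩ :=
    exists_isAffineOpen_mem_and_subset (X := N) (x := n) (U := ⊤) (Opens.mem_top n)
  letI := sectionsAlgebra (overHom k N) U
  letI := stalkAlgebra (overHom k N) n
  letI algx : Algebra Γ(N, U) (N.presheaf.stalk n) := (N.presheaf.germ U n hnU).hom.toAlgebra
  haveI : IsScalarTower k Γ(N, U) (N.presheaf.stalk n) :=
    IsScalarTower.of_algebraMap_eq fun c =>
      (RingHom.congr_fun (germ_comp_sectionsHom (overHom k N) U n hnU) c).symm
  haveI : IsLocalization.AtPrime (N.presheaf.stalk n) (hU.primeIdealOf ⟨n, hnU⟩).asIdeal :=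
    hU.isLocalization_stalk ⟨n, hnU⟩
  haveI : (hU.primeIdealOf ⟨n, hnU⟩).asIdeal.IsMaximal :=
    hU.primeIdealOf_isMaximal_of_isClosed ⟨n, hnU⟩ hn
  haveI : Algebra.FiniteType k Γ(N, U) := finiteType_sectionsHom_overHom k N ⟨U, hU⟩
  -- `Γ(N, U) → 𝒪_{N,n}/𝔪` is surjective
  have hsurj : Function.Surjective
      (algebraMap Γ(N, U) (ResidueField (N.presheaf.stalk n))) := by
    intro y
    obtain ⟨z, hz⟩ := (IsLocalization.AtPrime.equivQuotMaximalIdeal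
      (hU.primeIdealOf ⟨n, hnU⟩).asIdeal (N.presheaf.stalk n)).surjective y
    obtain ⟨a, rfl⟩ := Ideal.Quotient.mk_surjective z
    exact ⟨a, hz⟩
  haveI : Algebra.FiniteType k (ResidueField (N.presheaf.stalk n)) :=
    Algebra.FiniteType.of_surjective
      (IsScalarTower.toAlgHom k Γ(N, U) (ResidueField (N.presheaf.stalk n))) hsurj
  exact finite_of_finite_type_of_isJacobsonRing k (ResidueField (N.presheaf.stalk n))

/-! ## The closed step of the roof engine -/

/-- **The roof engine, CLOSED STEP** (sub-goal of the stub `stub_roofEngine`, line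
`closed-point-slice`). Data: the atom in algebraized form `hA` (fibre-supported regular blowing
ups over regular local bases essentially of finite type over the perfect field `k`, `dim ≤ 4`,
residue field finite over `k`); a REGULAR ROOF `q : M → N` at the closed bad point `x` (`N`
integral of finite type over `k`, `dim N ≤ 4`, `q` proper birational, `𝒪_{N,q x}` regular); the
current model `f : X' → M` (proper birational, `X'` integral) regular over `M ∖ C`, where the bad
set `C ∌ η_M` consists of closed points. Conclusion: a blowing up `f' : X'' → X'` whose centre
lies over points `m` with `q m = q x` (so not over `η_M`), such that every singular point of `X''`
lies over `C ∖ {x}`. PROOF (Temkin 2008, proof of Prop. 2.3.4, run over the base `N` at the point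
`n = q x`): the local scheme `T = X' ×_N Spec 𝒪_{N,n}` is integral, proper and birational over
`Spec 𝒪_{N,n}` and regular off the closed fibre (a bad point `m ∈ C` under a point of `T` would
have `q m` closed and a generization of `n`, so `q m = n`); `hA` gives a fibre-supported blowing
up `Bl_𝓘 T → T` with regular source; `𝓘` extends to `𝓙 ⊆ 𝒪_{X'}` supported on the closure of
its support (Lemma 2.1.1), which lies over `q⁻¹(n) ∌ η_M` (`q` is injective over its dense open of
isomorphy, which contains `η_M` and then `x`); `X'' = Bl_𝓙 X'` is regular over the generizations
of `n` because `X'' ×_{X'} T ≅ Bl_𝓘 T` (flat base change and uniqueness of blowing ups) and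
`X'' ×_{X'} T → X''` identifies local rings, and unchanged off `Supp 𝓙`.
[cite: Temkin2008, Prop. 2.3.4 (proof, p. 12) and Lemma 2.1.1] -/
theorem stub_roofEngineClosedStep (p : ℕ)
    (hA : ∀ (k : Type) [Field k] [CharP k p] [PerfectField k] (S : Type) [CommRing S]
      [IsRegularLocalRing S] [Algebra k S] [Algebra.EssFiniteType k S], ringKrullDim S ≤ (4 : ℕ) →
      Module.Finite k (S ⧸ IsLocalRing.maximalIdeal S) →
      ∀ (T : Scheme.{0}) (f : T ⟶ Spec (.of S)), IsIntegral T → IsProper f → IsBirational f →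
        (∀ t : T, f.base t ≠ IsLocalRing.closedPoint S → IsRegularLocalRing (T.presheaf.stalk t)) →
        ∃ (J : T.IdealSheafData) (T' : Scheme.{0}) (π : T' ⟶ T), J ≠ ⊥ ∧
          (∀ t : T, t ∈ J.support → f.base t = IsLocalRing.closedPoint S) ∧
          IsBlowup π J ∧ Scheme.IsRegular T')
    (k : Type) [Field k] [CharP k p] [PerfectField k] {M N X' : Scheme.{0}}
    (gN : N ⟶ Spec (.of k)) [LocallyOfFiniteType gN] [QuasiCompact gN] [IsIntegral N]
    (hdimN : topologicalKrullDim N ≤ 4) (q : M ⟶ N) [IsProper q] (hqbir : IsBirational q)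
    [IsIntegral M] (f : X' ⟶ M) [IsProper f] [IsIntegral X'] (hfbir : IsBirational f)
    (C : Set M) (hC : ∀ c ∈ C, IsClosed ({c} : Set M)) (hηC : genericPoint M ∉ C)
    (hreg : ∀ x' : X', f x' ∉ C → x' ∈ Scheme.regularLocus X') (x : M) (hxC : x ∈ C)
    (hregN : IsRegularLocalRing (N.presheaf.stalk (q x))) :
    ∃ (X'' : Scheme.{0}) (f' : X'' ⟶ X') (J' : X'.IdealSheafData), IsBlowup f' J' ∧
      genericPoint M ∉ f '' (J'.support : Set X') ∧
      ∀ x'' : X'', x'' ∉ Scheme.regularLocus X'' → f (f' x'') ∈ C ∧ f (f' x'') ≠ x := by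
  -- everything in sight is Noetherian
  haveI : IsNoetherian N := Scheme.isNoetherian_of_finiteType_over_field gN
  haveI : IsNoetherian M := Scheme.isNoetherian_of_finiteType_over_field (q ≫ gN)
  haveI : IsNoetherian X' := Scheme.isNoetherian_of_finiteType_over_field ((f ≫ q) ≫ gN)
  -- the roof point `n = q x` is closed, as is `q m` for every `m ∈ C`
  set n : N := q x with hn
  have hCn : ∀ m ∈ C, q m ⤳ n → q m = n := fun m hm hmn => by
    have h1 : IsClosed ({q m} : Set N) := by
      simpa only [Set.image_singleton] using q.isClosedMap _ (hC m hm)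
    have h2 : n ∈ closure ({q m} : Set N) := hmn.mem_closure
    rw [h1.closure_eq, Set.mem_singleton_iff] at h2
    exact h2.symm
  have hncl : IsClosed ({n} : Set N) := by
    simpa only [Set.image_singleton] using q.isClosedMap _ (hC x hxC)
  -- `q η_M ≠ n`: `q` is injective on the dense open `q⁻¹(U) ∋ η_M` over which it is an isomorphism
  have hqη : q (genericPoint M) ≠ n := by
    intro hq
    obtain ⟨U, -, hU', hiso⟩ := hqbir
    haveI := hiso
    have hηU : genericPoint M ∈ ((q ⁻¹ᵁ U : M.Opens) : Set M) :=
      genericPoint_mem_of_isOpen (q ⁻¹ᵁ U).2 hU'.nonempty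
    have hxU : x ∈ ((q ⁻¹ᵁ U : M.Opens) : Set M) := by
      change q x ∈ (U : Set N)
      rw [← hn, ← hq]
      exact hηU
    have hinj := (ConcreteCategory.bijective_of_isIso (q ∣_ U).base).1
    have heq : (⟨genericPoint M, hηU⟩ : ↥(q ⁻¹ᵁ U)) = ⟨x, hxU⟩ := by
      apply hinj
      apply Subtype.ext
      rw [morphismRestrict_base_coe, morphismRestrict_base_coe]
      change q (genericPoint M) = q x
      rw [hq, hn]
    have heq' : genericPoint M = x := congrArg Subtype.val heq
    exact hηC (heq' ▸ hxC)
  -- the local scheme `T = X' ×_N Spec 𝒪_{N,n}` over the roof point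
  haveI : Flat (N.fromSpecStalk n) := flat_fromSpecStalk N n
  haveI : IsNoetherian (pullback (f ≫ q) (N.fromSpecStalk n)) := {}
  have hfq : IsBirational (f ≫ q) := hfbir.comp hqbir
  haveI hTint : IsIntegral (pullback (f ≫ q) (N.fromSpecStalk n)) :=
    isIntegral_pullback_fromSpecStalk (f ≫ q) hfq n
  have hTbir : IsBirational (pullback.snd (f ≫ q) (N.fromSpecStalk n)) :=
    isBirational_pullback_snd_fromSpecStalk (f ≫ q) hfq n
  have hfj : ∀ s : ↑(pullback (f ≫ q) (N.fromSpecStalk n)),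
      q (f (pullback.fst (f ≫ q) (N.fromSpecStalk n) s)) =
        N.fromSpecStalk n (pullback.snd (f ≫ q) (N.fromSpecStalk n) s) := fun s => by
    rw [← Scheme.Hom.comp_apply, ← Scheme.Hom.comp_apply, pullback.condition,
      Scheme.Hom.comp_apply]
  -- `T` is regular off the closed fibre: `C` consists of closed points
  have hoff : ∀ t : ↑(pullback (f ≫ q) (N.fromSpecStalk n)),
      pullback.snd (f ≫ q) (N.fromSpecStalk n) t ≠ closedPoint (N.presheaf.stalk n) →
        IsRegularLocalRing ((pullback (f ≫ q) (N.fromSpecStalk n)).presheaf.stalk t) := by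
    intro t ht
    have h1 : N.fromSpecStalk n (pullback.snd (f ≫ q) (N.fromSpecStalk n) t) ≠ n := fun h =>
      ht ((N.fromSpecStalk n).isEmbedding.injective
        (h.trans Scheme.fromSpecStalk_closedPoint.symm))
    have h2 : N.fromSpecStalk n (pullback.snd (f ≫ q) (N.fromSpecStalk n) t) ⤳ n :=
      Scheme.range_fromSpecStalk.le ⟨_, rfl⟩
    have h3 : f (pullback.fst (f ≫ q) (N.fromSpecStalk n) t) ∉ C := fun hm =>
      h1 (by rw [← hfj]; exact hCn _ hm (hfj t ▸ h2))
    exact (Scheme.mem_regularLocus _).mp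
      ((mem_regularLocus_iff_pullback_fst_fromSpecStalk (f ≫ q) n t).mpr (hreg _ h3))
  -- the base `S = 𝒪_{N,n}`: regular local, essentially of finite type over `k`, `dim ≤ 4`,
  -- residue field finite over `k`
  letI : N.Over (Spec (.of k)) := ⟨gN⟩
  haveI : LocallyOfFiniteType (N ↘ Spec (.of k)) := ‹LocallyOfFiniteType gN›
  letI := stalkAlgebra (overHom k N) n
  haveI : Algebra.EssFiniteType k (N.presheaf.stalk n) := essFiniteType_stalk_overHom k N n
  haveI : IsRegularLocalRing (N.presheaf.stalk n) := hregN
  have hfin : Module.Finite k (N.presheaf.stalk n ⧸ maximalIdeal (N.presheaf.stalk n)) :=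
    finite_residue_stalk_overHom k N n hncl
  have hdimS : ringKrullDim (N.presheaf.stalk n) ≤ (4 : ℕ) :=
    (ringKrullDim_stalk_le_topologicalKrullDim N n).trans (by exact_mod_cast hdimN)
  -- the atom: a fibre-supported blowing up of `T` with regular source
  obtain ⟨JT, T', π, -, hJTsupp, hπ, hT'reg⟩ := hA k (N.presheaf.stalk n) hdimS hfin
    (pullback (f ≫ q) (N.fromSpecStalk n)) (pullback.snd (f ≫ q) (N.fromSpecStalk n)) hTint
    inferInstance hTbir hoff
  -- extend its centre to `X'` (Lemma 2.1.1) and blow `X'` up along the extension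
  obtain ⟨J', hJ'JT, hJ'supp⟩ := exists_idealSheaf_extension_fromSpecStalk (f ≫ q) n JT
  obtain ⟨X'', f', hf'⟩ := exists_isBlowup X' J'
  -- the new centre lies over `q⁻¹(n)`
  have hJ'n : ∀ x' ∈ (J'.support : Set X'), q (f x') = n := by
    have hcl : IsClosed ((f ≫ q) ⁻¹' {n}) := hncl.preimage (f ≫ q).continuous
    have hsub : pullback.fst (f ≫ q) (N.fromSpecStalk n) '' (JT.support : Set _) ⊆
        (f ≫ q) ⁻¹' {n} := by
      rintro _ ⟨s, hs, rfl⟩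
      rw [Set.mem_preimage, Set.mem_singleton_iff, Scheme.Hom.comp_apply, hfj, hJTsupp s hs,
        Scheme.fromSpecStalk_closedPoint]
    intro x' hx'
    rw [hJ'supp] at hx'
    have := hcl.closure_subset_iff.mpr hsub hx'
    rwa [Set.mem_preimage, Set.mem_singleton_iff, Scheme.Hom.comp_apply] at this
  refine ⟨X'', f', J', hf', ?_, fun x'' hx'' => ?_⟩
  · rintro ⟨x', hx', hη⟩
    exact hqη (by rw [← hη]; exact hJ'n x' hx')
  -- over the generizations of `n`, `X''` is regular: `X'' ×_{X'} T ≅ T'`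
  have hb : ¬ q (f (f' x'')) ⤳ n := by
    intro hsp
    apply hx''
    have hrange : f' x'' ∈ Set.range (pullback.fst (f ≫ q) (N.fromSpecStalk n)) := by
      rw [range_pullback_fst_fromSpecStalk]
      change (f ≫ q) (f' x'') ⤳ n
      rwa [Scheme.Hom.comp_apply]
    obtain ⟨s, hs⟩ := hrange
    have hT' : IsBlowup (pullback.snd f' (pullback.fst (f ≫ q) (N.fromSpecStalk n))) JT := by
      rw [← hJ'JT]
      exact hf'.pullback_snd_of_flat _
    obtain ⟨e, -, -⟩ := hT'.unique hπ
    have hx''range :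
        x'' ∈ Set.range (pullback.fst f' (pullback.fst (f ≫ q) (N.fromSpecStalk n))) := by
      rw [Scheme.Pullback.range_fst]
      exact ⟨s, hs⟩
    obtain ⟨t, rfl⟩ := hx''range
    refine (mem_regularLocus_iff_of_flat_of_isPreimmersion _ t).mp ?_
    exact (mem_regularLocus_iff_of_flat_of_isPreimmersion e.hom t).mpr (hT'reg _)
  refine ⟨?_, fun h => hb (by rw [h])⟩
  -- over `M ∖ C`: `X'` is regular there and `f'` is an isomorphism off its centre
  by_contra hm
  have h1 : f' x'' ∈ Scheme.regularLocus X' := hreg _ hm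
  have h2 : f' x'' ∉ (J'.support : Set X') := fun h => hb (by rw [hJ'n _ h])
  haveI := hf'.isIso_compl
  exact hx'' ((mem_regularLocus_iff_of_isIso_morphismRestrict f'
    ⟨(J'.support : Set X')ᶜ, J'.support.isClosed.isOpen_compl⟩ x'' h2).mpr h1)

end Summit.ResolutionOfSingularities.ResolutionOfSingularities.Theorems

end
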